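import Literature.NumberTheory.LFunctions.LiouvilleCertificate.Chunk0
import Literature.NumberTheory.LFunctions.LiouvilleCertificate.Chunk1
import Literature.NumberTheory.LFunctions.LiouvilleCertificate.Chunk2
import Literature.NumberTheory.LFunctions.LiouvilleCertificate.Chunk3
import Literature.NumberTheory.LFunctions.LiouvilleCertificate.Chunk4
import Literature.NumberTheory.LFunctions.LiouvilleCertificate.Chunk5
import Literature.NumberTheory.LFunctions.LiouvilleCertificate.Chunk6
import Literature.NumberTheory.LFunctions.LiouvilleCertificate.Final
import Literature.NumberTheory.LFunctions.MertensCertificate.Chunk00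
import Literature.NumberTheory.LFunctions.MertensCertificate.Chunk01
import Literature.NumberTheory.LFunctions.MertensCertificate.Chunk02
import Literature.NumberTheory.LFunctions.MertensCertificate.Chunk03
import Literature.NumberTheory.LFunctions.MertensCertificate.Chunk04
import Literature.NumberTheory.LFunctions.MertensCertificate.Chunk05
import Literature.NumberTheory.LFunctions.MertensCertificate.Chunk06
import Literature.NumberTheory.LFunctions.MertensCertificate.Chunk07
import Literature.NumberTheory.LFunctions.MertensCertificate.Chunk08
import Literature.NumberTheory.LFunctions.MertensCertificate.Chunk09
import Literature.NumberTheory.LFunctions.MertensCertificate.Chunk10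
import Literature.NumberTheory.LFunctions.MertensCertificate.Chunk11
import Literature.NumberTheory.LFunctions.MertensCertificate.Chunk12
import Literature.NumberTheory.LFunctions.MertensCertificate.Chunk13
import Literature.NumberTheory.LFunctions.MertensCertificate.Chunk14
import Literature.NumberTheory.LFunctions.MertensCertificate.Chunk15
import Literature.NumberTheory.LFunctions.MertensCertificate.Chunk16
import Literature.NumberTheory.LFunctions.MertensCertificate.Chunk17
import Literature.NumberTheory.LFunctions.MertensCertificate.Chunk18
import Literature.NumberTheory.LFunctions.MertensCertificate.Chunk19
import Literature.NumberTheory.LFunctions.MertensCertificate.Top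
import HarnessLib

/-!
# Haselgrove 1958, assembled: `L(n) > 0` and `T(n) < 0` for infinitely many `n` — unconditionally

Topic `Literature/NumberTheory/LFunctions` (trunk T-ANT). Sibling proof file of
`LiouvilleKernelTheorem.lean` proving the numerical hypotheses of its theorems
`frequently_liouvilleSum_natCast_pos_of_polyaKernelSum_pos` /
`frequently_liouvilleHarmonicSum_natCast_neg_of_turanKernelSum_neg` — the numerical content of
C. B. Haselgrove, *A disproof of a conjecture of Pólya*, Mathematika 5 (1958), 141–145, in the form
printed by Borwein–Ferguson–Mossinghoff, Math. Comp. 77 (2008), §1 pp. 1683–1684 ("Haselgrove found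
that selecting `m = 1000` and `y = 831.847` produces `A*_m(y) ≈ .00495`. This computation employed the
first 649 zeros of the Riemann zeta function … selecting `m = 1000` and `y = 853.853` or
`y = 996.980` produces a negative value of `B*_m(y)`") — and with it the two **Ingham halves** of
Haselgrove's theorem "both `L(x)` and `T(x)` change sign infinitely often":

* `frequently_liouvilleSum_natCast_pos` — **`L(n) > 0` for infinitely many integers `n`** (the
  disproof of Pólya's conjecture by Ingham's method, independent of the tree's computational
  witness `L(906 150 257) = 1`);
* `frequently_liouvilleHarmonicSum_natCast_neg` — **`T(n) < 0` for infinitely many integers `n`**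
  (the answer to Turán's problem; no value of `n` with `T(n) < 0` is computed — the least one is
  `72 185 376 951 205`, BFM Theorem 1).

This file only chains results already in the tree:

1. the kernel theorems for `L` and `T` (`polya_kernelTheorem`, `turan_kernelTheorem`,
   `LiouvilleKernelTheorem.lean`: Ingham's smoothed explicit formula `InghamSmoothing.lean`, the
   regular part of `ζ(1+2s)q(s)/ζ(½+s)` `ZetaQuotientKernelTheorem.lean`, Landau's theorem for `L`
   and `T` under one-sided bounds `LiouvilleOneSided.lean`, `TuranOneSided.lean`), in the form
   "`Re A*(y) > 0` at one `y` ⟹ `L(n) > 0` infinitely often" (and dually for `T`);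
2. the certified recomputation of the numerics (`LiouvilleCertificate.lean`, soundness theorem
   `ZetaNumerics.Liouville.numerics_of_checks`): the 2000 zero brackets of width `2⁻²⁴⁰` and the
   zero count `N(2516) = 2000` certified by the tree's Odlyzko–te Riele block files
   (`MertensCertificate/Chunk00.lean` … `Chunk19.lean`, `Top.lean`), and, for the first 649 zeros
   (those below Haselgrove's height `m = 1000`), enclosures of the summands of `A*`, `B*` with the
   Jurkat–Peyerimhoff kernel at the points `y_L = 831.84844`, `y_T = 996.98037`, evaluated block by
   block in `LiouvilleCertificate/Chunk0.lean` … `Chunk6.lean`, `Final.lean` (one `native_decide`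
   each): `Re A*(y_L) > 0` (`≈ 0.0183`) and `Re B*(y_T) < 0` (`≈ -0.0627`).

## Axioms

Everything below depends on `propext`, `Classical.choice`, `Quot.sound` and on the `native_decide`
auxiliary axioms of the 21 Odlyzko–te Riele block evaluations and the 8 block evaluations of
`LiouvilleCertificate/` (trust in the Lean compiler, the `Lean.ofReduceBool` / `Lean.trustCompiler`
family) — exactly as the printed proof is a machine computation (Haselgrove 1958 on the EDSAC;
BFM 2008 §1). Proposal flag `computational`.

## References

* [HaselgroveMathematika1958] C. B. Haselgrove, *A disproof of a conjecture of Pólya*, Mathematika 5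
  (1958), 141–145.
* [BorweinFergusonMossinghoff2008] P. Borwein, R. Ferguson, M. J. Mossinghoff, *Sign changes in
  sums of the Liouville function*, Math. Comp. 77 (2008), 1681–1694, §1 (3)–(7) pp. 1683–1684.
-/

noncomputable section

open Filter

namespace Literature.NumberTheory.LFunctions

open LiouvilleCertificate.ZetaNumerics.Liouville MertensCertificate.ZetaNumerics.Mertens
  ZetaNumerics.Liouville in
/-- **The certified numerics** (`T = 2516`, `T₁ = 1000`, `y_L = 831.84844`, `y_T = 996.98037`): the
zeros of `ζ` with `0 < Re ρ < 1`, `|Im ρ| < 2516` are simple and on the line, `Re A*(y_L) > 0` and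
`Re B*(y_T) < 0` — the soundness theorem `ZetaNumerics.Liouville.numerics_of_checks` applied to the
compiled block evaluations. [cite: BorweinFergusonMossinghoff2008, §1 pp. 1683–1684; HaselgroveMathematika1958] -/
theorem haselgrove_numerics_holds :
    (∀ ρ : ℂ, riemannZeta ρ = 0 → 0 < ρ.re → ρ.re < 1 → |ρ.im| < ZetaNumerics.Mertens.heightT0 →
        ρ.re = 1 / 2 ∧ deriv riemannZeta ρ ≠ 0) ∧
      0 < (polyaKernelSum kL ZetaNumerics.Mertens.heightT0 yL).re ∧
      (turanKernelSum kL ZetaNumerics.Mertens.heightT0 yT).re < 0 := by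
  refine numerics_of_checks (fun k hk ↦ ?_) MertensCertificate.ZetaNumerics.Mertens.checkTop_holds
    (fun k hk ↦ ?_) LiouvilleCertificate.ZetaNumerics.Liouville.checkFinal_holds
  · have hk20 : k < 20 := hk
    interval_cases k
    · exact checkChunk_00
    · exact checkChunk_01
    · exact checkChunk_02
    · exact checkChunk_03
    · exact checkChunk_04
    · exact checkChunk_05
    · exact checkChunk_06
    · exact checkChunk_07
    · exact checkChunk_08
    · exact checkChunk_09
    · exact checkChunk_10
    · exact checkChunk_11
    · exact checkChunk_12
    · exact checkChunk_13
    · exact checkChunk_14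
    · exact checkChunk_15
    · exact checkChunk_16
    · exact checkChunk_17
    · exact checkChunk_18
    · exact checkChunk_19
  · have hk7 : k < 7 := hk
    interval_cases k
    · exact checkChunk_0
    · exact checkChunk_1
    · exact checkChunk_2
    · exact checkChunk_3
    · exact checkChunk_4
    · exact checkChunk_5
    · exact checkChunk_6

/-- `T₁ = 1000 ≤ T = 2516`, both positive (the heights of the certificate). [folklore] -/
theorem heightT1_pos_le :
    (0 : ℝ) < ZetaNumerics.Liouville.heightT1 ∧
      (ZetaNumerics.Liouville.heightT1 : ℝ) ≤ ZetaNumerics.Mertens.heightT0 := by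
  rw [ZetaNumerics.Liouville.heightT1_real, ZetaNumerics.Mertens.heightT0_real]; norm_num

/-- **Haselgrove 1958, Pólya's side, quantitative**: there is `a > 0` with `L(x) > a√x` for
arbitrarily large `x` (`limsup L(x)/√x > 0`). [cite: HaselgroveMathematika1958, main theorem] [cite: BorweinFergusonMossinghoff2008, §1 (5) p. 1683] -/
theorem exists_pos_frequently_liouvilleSum_gt :
    ∃ a : ℝ, 0 < a ∧ ∃ᶠ x : ℝ in atTop, a * Real.sqrt x < liouvilleSum x :=
  exists_pos_frequently_liouvilleSum_gt_of_polyaKernelSum_pos heightT1_pos_le.1 heightT1_pos_le.2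
    haselgrove_numerics_holds.1 haselgrove_numerics_holds.2.1

/-- **Haselgrove 1958: `L(n) > 0` for infinitely many integers `n`** — Pólya's conjecture fails
infinitely often (the Ingham half (L⁺) of "`L(x)` changes sign infinitely often"), unconditionally.
[cite: HaselgroveMathematika1958, main theorem] [cite: BorweinFergusonMossinghoff2008, §1 p. 1683] -/
theorem frequently_liouvilleSum_natCast_pos : ∃ᶠ n : ℕ in atTop, 0 < liouvilleSum n :=
  frequently_liouvilleSum_natCast_pos_of_polyaKernelSum_pos heightT1_pos_le.1 heightT1_pos_le.2
    haselgrove_numerics_holds.1 haselgrove_numerics_holds.2.1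

/-- **Haselgrove 1958, Turán's side, quantitative**: there is `a < 0` with `T(x)√x < a` for
arbitrarily large `x` (`liminf T(x)√x < 0`). [cite: HaselgroveMathematika1958, main theorem] [cite: BorweinFergusonMossinghoff2008, §1 (7) p. 1684] -/
theorem exists_neg_frequently_liouvilleHarmonicSum_lt :
    ∃ a : ℝ, a < 0 ∧ ∃ᶠ x : ℝ in atTop, liouvilleHarmonicSum x * Real.sqrt x < a :=
  exists_neg_frequently_liouvilleHarmonicSum_lt_of_turanKernelSum_neg heightT1_pos_le.1
    heightT1_pos_le.2 haselgrove_numerics_holds.1 haselgrove_numerics_holds.2.2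

/-- **Haselgrove 1958: `T(n) < 0` for infinitely many integers `n`** — Turán's sum changes sign
(the Ingham half (T⁻)), unconditionally. [cite: HaselgroveMathematika1958, main theorem] [cite: BorweinFergusonMossinghoff2008, §1 p. 1684] -/
theorem frequently_liouvilleHarmonicSum_natCast_neg : ∃ᶠ n : ℕ in atTop, liouvilleHarmonicSum n < 0 :=
  frequently_liouvilleHarmonicSum_natCast_neg_of_turanKernelSum_neg heightT1_pos_le.1
    heightT1_pos_le.2 haselgrove_numerics_holds.1 haselgrove_numerics_holds.2.2

end Literature.NumberTheory.LFunctions
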